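import Summits.HodgeConjecture.CorCM.IrreducibleOddWeightsMultiClassBlocks
import HarnessLib

/-!
# The multiplicity formula across all isotypic classes, III: ADDITIVITY AND DOMINATION ARE DECIDED CLASS BY CLASS —
# `(S(W_s))_s independent ⟺ ∀ c, (S(p^s_c))_s independent`;  `S(W′) ≤ ⨆_s S(W_s) ⟺ ∀ c, S(p′_c) ≤ ⨆_s S(p^s_c)`

COR-CM (cell `pub-hodgecm2`, binder seat `b16` gen 75, count-neutral claim THE MULTIPLICITY FORMULA ACROSS ALL
ISOTYPIC CLASSES FOR A WHOLE FAMILY, file M3 — abstract `G`-set level; theorems only, no definition, no named fact,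
no `sorry`).  NEW as stated, hence under `Summits/`.  HONEST FRAMING: linear algebra of translates of functions on
finite `G`-sets (files M1 `…MultiClassShadows`, M2 `…MultiClassBlocks`); nothing about Hodge classes is asserted,
`HC_CM` is neither used nor asserted.  The reading for CM types (`S(W_i) = MC_i = X^*(MT(A_i))_ℚ`, additivity of
`dim Hg`, Hodge domination by a sub-product) is file M5 `…MultiClassRank`.

SETTING (files M1/M2).  Pairwise non-isomorphic reference irreducibles `A_c ≤ ℚ^{Y_c}` (`c ∈ C`); slots `s ∈ S`
with pivots `Y_s`, class parts `p^s_c = Σ_j ι^s_{c,j}(b^s_{c,j})` (equivariant embeddings jointly independent on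
`A_c`, components in `A_c`), slot vectors `W_s = Σ_c p^s_c`; one more slot `Y′` with `W′ = Σ_c p′_c`,
`p′_c = Σ_k ι′_{c,k}(b′_{c,k})`; `S(w) = span{g ↦ w(g·y)} ≤ ℚ^G`; containers `𝒞_c = Σ_y Θ_y(A_c)`.

* §1 **ADDITIVITY CLASS BY CLASS** (`iSupIndep_span_shadowCoeff_iff_forall_of_classes`): the slot spaces `S(W_s)`
  are INDEPENDENT in `ℚ^G` iff for EVERY class `c` the class parts `S(p^s_c)` (`s ∈ S`) are independent —
  `dim ⨆_s S(W_s) = Σ_c dim ⨆_s S(p^s_c)` and `dim S(W_s) = Σ_c dim S(p^s_c)` (M2) with `dim ⨆_s ≤ Σ_s` class by class.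
* §2 **DOMINATION CLASS BY CLASS** (`span_shadowCoeff_le_iSup_iff_forall_of_classes`): **`S(W′) ≤ ⨆_s S(W_s) ⟺
  ∀ c, S(p′_c) ≤ ⨆_s S(p^s_c)`** (`S(p′_c) ≤ 𝒞_c`, the class blocks `⨆_s S(p^s_c) ≤ 𝒞_c`, and the containers are
  independent — M2's lattice step); family against family `iSup_span_shadowCoeff_le_iSup_iff_forall_of_classes` and
  `iSup_span_shadowCoeff_eq_iSup_iff_forall_of_classes`.
File M4 `…MultiClassCommutant` reads each class condition over the commutant `𝒟_c` of `A_c` (gen 74 S3): independent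
`⟺` the D-spans `D_c⟨b^s_c⟩` are independent in `A_c`; dominated `⟺ D_c⟨b′_c⟩ ≤ ⨆_s D_c⟨b^s_c⟩`.

## References

* [Serre1977] J.-P. Serre, *Linear Representations of Finite Groups*, GTM 42, §2.6 (canonical decomposition).
* [Lang2002] S. Lang, *Algebra*, 3rd ed., XVII §2, XVII §3.
* [Gordon1999HodgeAVSurvey] B. B. Gordon, *A survey of the Hodge conjecture for abelian varieties*, §3 Theorem (proof),
  7.5–7.7, 9.4.3.
* [Deligne1982HodgeCycles] P. Deligne, *Hodge cycles on abelian varieties*, LNM 900 (1982), I.5 (p. 53).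
-/

set_option autoImplicit false

noncomputable section

open scoped BigOperators Classical

universe u uC uJ uJ' uS uS' v v' v'' vC w

namespace Summit.HodgeConjecture.CorCM.IrrOdd

open Literature.NumberTheory.ComplexMultiplication

variable {G : Type w} [Group G]
  {C : Type uC} [Fintype C] {Yc : C → Type vC} [∀ c, MulAction G (Yc c)] [∀ c, Fintype (Yc c)]
  {Ar : ∀ c, Submodule ℚ (Yc c → ℚ)}
  {S : Type uS} [Fintype S] {Yf : S → Type v} [∀ s, MulAction G (Yf s)] [∀ s, Fintype (Yf s)]
  {JJ : S → C → Type uJ} [∀ s c, Fintype (JJ s c)]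
  {Y₁ : Type v''} [MulAction G Y₁] [Fintype Y₁] {J₁ : C → Type uJ'} [∀ c, Fintype (J₁ c)]

/-! ### §1 Additivity is decided class by class -/

omit [Fintype C] [∀ c, Fintype (Yc c)] [∀ c, MulAction G (Yc c)] [Fintype Y₁] [MulAction G Y₁]
  [∀ c, Fintype (J₁ c)] [Group G] in
/-- `dim ⨆_s U_s ≤ Σ_s dim U_s` for finitely many finite-dimensional subspaces (of any space). [folklore] -/
theorem finrank_iSup_le_sum_finrank_of_finite {M : Type u} [AddCommGroup M] [Module ℚ M] (U : S → Submodule ℚ M)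
    [∀ s, Module.Finite ℚ (U s)] : Module.finrank ℚ ↥(⨆ s, U s) ≤ ∑ s, Module.finrank ℚ (U s) :=
  Nat.le.intro (finrank_iSup_add_finrank_ker_lsum_eq_sum U)

/-- **ADDITIVITY IS DECIDED CLASS BY CLASS.**  For slot vectors `W_s = Σ_c p^s_c` assembled from pairwise
non-isomorphic reference irreducibles: **the spaces `S(W_s)` (`s ∈ S`) are INDEPENDENT iff for every class `c` the
spaces `S(p^s_c)` (`s ∈ S`) are independent** — `dim ⨆_s S(W_s) = Σ_c dim ⨆_s S(p^s_c)`, `Σ_s dim S(W_s) =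
Σ_c Σ_s dim S(p^s_c)` (file M2) and `dim ⨆_s S(p^s_c) ≤ Σ_s dim S(p^s_c)` for each `c`. [cite: Serre1977, §2.6]
[cite: Gordon1999HodgeAVSurvey, §3 Theorem (proof), 7.5–7.7] [cite: Deligne1982HodgeCycles, I.5 (p. 53)] -/
theorem iSupIndep_span_shadowCoeff_iff_forall_of_classes
    (hRst : ∀ c (k : G) (a : Yc c → ℚ), a ∈ Ar c → (fun y => a (k • y)) ∈ Ar c)
    (hRirr : ∀ c (W : Submodule ℚ (Yc c → ℚ)), W ≤ Ar c → W ≠ ⊥ →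
      (∀ (k : G) (f : Yc c → ℚ), f ∈ W → (fun y => f (k • y)) ∈ W) → W = Ar c)
    (hsep : ∀ c c' (L : (Yc c → ℚ) →ₗ[ℚ] (Yc c' → ℚ)), c ≠ c' → Ar c ≠ ⊥ → (∀ a ∈ Ar c, L a ∈ Ar c') →
      (∀ a ∈ Ar c, L a = 0 → a = 0) →
      (∀ (k : G) (a : Yc c → ℚ), a ∈ Ar c → L (fun y => a (k • y)) = fun y => L a (k • y)) → False)
    (ι : ∀ s c, JJ s c → ((Yc c → ℚ) →ₗ[ℚ] (Yf s → ℚ)))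
    (hιeq : ∀ s c (j : JJ s c) (k : G) (a : Yc c → ℚ), a ∈ Ar c →
      ι s c j (fun y => a (k • y)) = fun y => ι s c j a (k • y))
    (hind : ∀ s c (f : JJ s c → (Yc c → ℚ)), (∀ j, f j ∈ Ar c) → ∑ j, ι s c j (f j) = 0 → ∀ j, f j = 0)
    {b : ∀ s c, JJ s c → (Yc c → ℚ)} (hb : ∀ s c j, b s c j ∈ Ar c) :
    (iSupIndep fun s => Submodule.span ℚ
        (Set.range fun y : Yf s => fun g : G => (∑ c, ∑ j, ι s c j (b s c j)) (g • y))) ↔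
      ∀ c, iSupIndep fun s => Submodule.span ℚ
        (Set.range fun y : Yf s => fun g : G => (∑ j, ι s c j (b s c j)) (g • y)) := by
  haveI : ∀ s, Module.Finite ℚ ↥(Submodule.span ℚ
      (Set.range fun y : Yf s => fun g : G => (∑ c, ∑ j, ι s c j (b s c j)) (g • y))) := fun s =>
    Module.Finite.span_of_finite ℚ (Set.finite_range _)
  haveI : ∀ s c, Module.Finite ℚ ↥(Submodule.span ℚ
      (Set.range fun y : Yf s => fun g : G => (∑ j, ι s c j (b s c j)) (g • y))) := fun s c =>
    Module.Finite.span_of_finite ℚ (Set.finite_range _)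
  rw [← finrank_iSup_eq_sum_finrank_iff_iSupIndep,
    finrank_iSup_span_shadowCoeff_eq_sum_of_classes hRst hRirr hsep ι hιeq hind hb,
    Finset.sum_congr rfl fun s _ =>
      finrank_span_shadowCoeff_eq_sum_of_classes hRst hRirr hsep (ι s) (hιeq s) (hind s) (hb s),
    Finset.sum_comm,
    Finset.sum_eq_sum_iff_of_le fun c _ => finrank_iSup_le_sum_finrank_of_finite (fun s => Submodule.span ℚ
      (Set.range fun y : Yf s => fun g : G => (∑ j, ι s c j (b s c j)) (g • y)))]
  refine forall_congr' fun c => ?_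
  rw [← finrank_iSup_eq_sum_finrank_iff_iSupIndep]
  simp only [Finset.mem_univ, true_implies]

/-! ### §2 Domination is decided class by class -/

omit [Fintype S] in
/-- **DOMINATION IS DECIDED CLASS BY CLASS: `S(W′) ≤ ⨆_s S(W_s) ⟺ ∀ c, S(p′_c) ≤ ⨆_s S(p^s_c)`** — one more slot
`Y′` with `W′ = Σ_c p′_c` is absorbed by the family iff every class part of it is absorbed by the class block of
the family (`S(p′_c)` and the block lie in the container `𝒞_c`, the containers are independent, file M2).
[cite: Serre1977, §2.6] [cite: Lang2002, XVII §2] [cite: Gordon1999HodgeAVSurvey, §3 Theorem (proof), 7.5–7.7] -/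
theorem span_shadowCoeff_le_iSup_iff_forall_of_classes
    (hRst : ∀ c (k : G) (a : Yc c → ℚ), a ∈ Ar c → (fun y => a (k • y)) ∈ Ar c)
    (hRirr : ∀ c (W : Submodule ℚ (Yc c → ℚ)), W ≤ Ar c → W ≠ ⊥ →
      (∀ (k : G) (f : Yc c → ℚ), f ∈ W → (fun y => f (k • y)) ∈ W) → W = Ar c)
    (hsep : ∀ c c' (L : (Yc c → ℚ) →ₗ[ℚ] (Yc c' → ℚ)), c ≠ c' → Ar c ≠ ⊥ → (∀ a ∈ Ar c, L a ∈ Ar c') →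
      (∀ a ∈ Ar c, L a = 0 → a = 0) →
      (∀ (k : G) (a : Yc c → ℚ), a ∈ Ar c → L (fun y => a (k • y)) = fun y => L a (k • y)) → False)
    (ι : ∀ s c, JJ s c → ((Yc c → ℚ) →ₗ[ℚ] (Yf s → ℚ))) (ι₁ : ∀ c, J₁ c → ((Yc c → ℚ) →ₗ[ℚ] (Y₁ → ℚ)))
    (hιeq : ∀ s c (j : JJ s c) (k : G) (a : Yc c → ℚ), a ∈ Ar c →
      ι s c j (fun y => a (k • y)) = fun y => ι s c j a (k • y))
    (hι₁eq : ∀ c (j : J₁ c) (k : G) (a : Yc c → ℚ), a ∈ Ar c →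
      ι₁ c j (fun y => a (k • y)) = fun y => ι₁ c j a (k • y))
    (hind : ∀ s c (f : JJ s c → (Yc c → ℚ)), (∀ j, f j ∈ Ar c) → ∑ j, ι s c j (f j) = 0 → ∀ j, f j = 0)
    (hind₁ : ∀ c (f : J₁ c → (Yc c → ℚ)), (∀ j, f j ∈ Ar c) → ∑ j, ι₁ c j (f j) = 0 → ∀ j, f j = 0)
    {b : ∀ s c, JJ s c → (Yc c → ℚ)} {b₁ : ∀ c, J₁ c → (Yc c → ℚ)}
    (hb : ∀ s c j, b s c j ∈ Ar c) (hb₁ : ∀ c j, b₁ c j ∈ Ar c) :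
    Submodule.span ℚ (Set.range fun y : Y₁ => fun g : G => (∑ c, ∑ j, ι₁ c j (b₁ c j)) (g • y)) ≤
        (⨆ s, Submodule.span ℚ
          (Set.range fun y : Yf s => fun g : G => (∑ c, ∑ j, ι s c j (b s c j)) (g • y))) ↔
      ∀ c, Submodule.span ℚ (Set.range fun y : Y₁ => fun g : G => (∑ j, ι₁ c j (b₁ c j)) (g • y)) ≤
        ⨆ s, Submodule.span ℚ (Set.range fun y : Yf s => fun g : G => (∑ j, ι s c j (b s c j)) (g • y)) := by
  rw [span_shadowCoeff_sum_classes_eq_iSup hRst hRirr hsep ι₁ hι₁eq hind₁ hb₁,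
    iSup_span_shadowCoeff_sum_classes_eq_iSup hRst hRirr hsep ι hιeq hind hb]
  constructor
  · intro h c
    exact le_of_le_iSup_of_iSupIndep (iSupIndep_container_of_classes hRst hRirr hsep)
      (fun c' => iSup_span_shadowCoeff_le_container c' ι hιeq hb)
      (span_shadowCoeff_sum_le_container (ι₁ c) (hι₁eq c) (hb₁ c)) ((le_iSup _ c).trans h)
  · exact fun h => iSup_mono h

omit [Fintype S] in
/-- **FAMILY AGAINST FAMILY: `⨆_t S(W′_t) ≤ ⨆_s S(W_s) ⟺ ∀ c, ⨆_t S(p′^t_c) ≤ ⨆_s S(p^s_c)`** (a second finite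
family of slots `Y′_t`, `t ∈ S′`, assembled from the same references). [cite: Serre1977, §2.6]
[cite: Gordon1999HodgeAVSurvey, §3 Theorem (proof), 7.5–7.7] [cite: Deligne1982HodgeCycles, I.5 (p. 53)] -/
theorem iSup_span_shadowCoeff_le_iSup_iff_forall_of_classes
    (hRst : ∀ c (k : G) (a : Yc c → ℚ), a ∈ Ar c → (fun y => a (k • y)) ∈ Ar c)
    (hRirr : ∀ c (W : Submodule ℚ (Yc c → ℚ)), W ≤ Ar c → W ≠ ⊥ →
      (∀ (k : G) (f : Yc c → ℚ), f ∈ W → (fun y => f (k • y)) ∈ W) → W = Ar c)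
    (hsep : ∀ c c' (L : (Yc c → ℚ) →ₗ[ℚ] (Yc c' → ℚ)), c ≠ c' → Ar c ≠ ⊥ → (∀ a ∈ Ar c, L a ∈ Ar c') →
      (∀ a ∈ Ar c, L a = 0 → a = 0) →
      (∀ (k : G) (a : Yc c → ℚ), a ∈ Ar c → L (fun y => a (k • y)) = fun y => L a (k • y)) → False)
    (ι : ∀ s c, JJ s c → ((Yc c → ℚ) →ₗ[ℚ] (Yf s → ℚ)))
    {S' : Type uS'} [Fintype S'] {Yf' : S' → Type v''} [∀ t, MulAction G (Yf' t)] [∀ t, Fintype (Yf' t)]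
    {JJ' : S' → C → Type uJ'} [∀ t c, Fintype (JJ' t c)]
    (ι' : ∀ t c, JJ' t c → ((Yc c → ℚ) →ₗ[ℚ] (Yf' t → ℚ)))
    (hιeq : ∀ s c (j : JJ s c) (k : G) (a : Yc c → ℚ), a ∈ Ar c →
      ι s c j (fun y => a (k • y)) = fun y => ι s c j a (k • y))
    (hι'eq : ∀ t c (j : JJ' t c) (k : G) (a : Yc c → ℚ), a ∈ Ar c →
      ι' t c j (fun y => a (k • y)) = fun y => ι' t c j a (k • y))
    (hind : ∀ s c (f : JJ s c → (Yc c → ℚ)), (∀ j, f j ∈ Ar c) → ∑ j, ι s c j (f j) = 0 → ∀ j, f j = 0)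
    (hind' : ∀ t c (f : JJ' t c → (Yc c → ℚ)), (∀ j, f j ∈ Ar c) → ∑ j, ι' t c j (f j) = 0 → ∀ j, f j = 0)
    {b : ∀ s c, JJ s c → (Yc c → ℚ)} {b' : ∀ t c, JJ' t c → (Yc c → ℚ)}
    (hb : ∀ s c j, b s c j ∈ Ar c) (hb' : ∀ t c j, b' t c j ∈ Ar c) :
    (⨆ t, Submodule.span ℚ
        (Set.range fun y : Yf' t => fun g : G => (∑ c, ∑ j, ι' t c j (b' t c j)) (g • y))) ≤
        (⨆ s, Submodule.span ℚ
          (Set.range fun y : Yf s => fun g : G => (∑ c, ∑ j, ι s c j (b s c j)) (g • y))) ↔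
      ∀ c, (⨆ t, Submodule.span ℚ
          (Set.range fun y : Yf' t => fun g : G => (∑ j, ι' t c j (b' t c j)) (g • y))) ≤
        ⨆ s, Submodule.span ℚ (Set.range fun y : Yf s => fun g : G => (∑ j, ι s c j (b s c j)) (g • y)) := by
  rw [iSup_le_iff]
  simp only [iSup_le_iff]
  rw [forall_comm]
  exact forall_congr' fun t => span_shadowCoeff_le_iSup_iff_forall_of_classes hRst hRirr hsep ι (ι' t) hιeq
    (hι'eq t) hind (hind' t) hb (hb' t)

/-- **`⨆_t S(W′_t) = ⨆_s S(W_s) ⟺ ∀ c, ⨆_t S(p′^t_c) = ⨆_s S(p^s_c)`** — two families have the same coefficient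
space iff they have the same class blocks. [cite: Serre1977, §2.6] [cite: Gordon1999HodgeAVSurvey, 7.5–7.7] -/
theorem iSup_span_shadowCoeff_eq_iSup_iff_forall_of_classes
    (hRst : ∀ c (k : G) (a : Yc c → ℚ), a ∈ Ar c → (fun y => a (k • y)) ∈ Ar c)
    (hRirr : ∀ c (W : Submodule ℚ (Yc c → ℚ)), W ≤ Ar c → W ≠ ⊥ →
      (∀ (k : G) (f : Yc c → ℚ), f ∈ W → (fun y => f (k • y)) ∈ W) → W = Ar c)
    (hsep : ∀ c c' (L : (Yc c → ℚ) →ₗ[ℚ] (Yc c' → ℚ)), c ≠ c' → Ar c ≠ ⊥ → (∀ a ∈ Ar c, L a ∈ Ar c') →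
      (∀ a ∈ Ar c, L a = 0 → a = 0) →
      (∀ (k : G) (a : Yc c → ℚ), a ∈ Ar c → L (fun y => a (k • y)) = fun y => L a (k • y)) → False)
    (ι : ∀ s c, JJ s c → ((Yc c → ℚ) →ₗ[ℚ] (Yf s → ℚ)))
    {S' : Type uS'} [Fintype S'] {Yf' : S' → Type v''} [∀ t, MulAction G (Yf' t)] [∀ t, Fintype (Yf' t)]
    {JJ' : S' → C → Type uJ'} [∀ t c, Fintype (JJ' t c)]
    (ι' : ∀ t c, JJ' t c → ((Yc c → ℚ) →ₗ[ℚ] (Yf' t → ℚ)))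
    (hιeq : ∀ s c (j : JJ s c) (k : G) (a : Yc c → ℚ), a ∈ Ar c →
      ι s c j (fun y => a (k • y)) = fun y => ι s c j a (k • y))
    (hι'eq : ∀ t c (j : JJ' t c) (k : G) (a : Yc c → ℚ), a ∈ Ar c →
      ι' t c j (fun y => a (k • y)) = fun y => ι' t c j a (k • y))
    (hind : ∀ s c (f : JJ s c → (Yc c → ℚ)), (∀ j, f j ∈ Ar c) → ∑ j, ι s c j (f j) = 0 → ∀ j, f j = 0)
    (hind' : ∀ t c (f : JJ' t c → (Yc c → ℚ)), (∀ j, f j ∈ Ar c) → ∑ j, ι' t c j (f j) = 0 → ∀ j, f j = 0)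
    {b : ∀ s c, JJ s c → (Yc c → ℚ)} {b' : ∀ t c, JJ' t c → (Yc c → ℚ)}
    (hb : ∀ s c j, b s c j ∈ Ar c) (hb' : ∀ t c j, b' t c j ∈ Ar c) :
    (⨆ t, Submodule.span ℚ
        (Set.range fun y : Yf' t => fun g : G => (∑ c, ∑ j, ι' t c j (b' t c j)) (g • y))) =
        (⨆ s, Submodule.span ℚ
          (Set.range fun y : Yf s => fun g : G => (∑ c, ∑ j, ι s c j (b s c j)) (g • y))) ↔
      ∀ c, (⨆ t, Submodule.span ℚ
          (Set.range fun y : Yf' t => fun g : G => (∑ j, ι' t c j (b' t c j)) (g • y))) =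
        ⨆ s, Submodule.span ℚ (Set.range fun y : Yf s => fun g : G => (∑ j, ι s c j (b s c j)) (g • y)) := by
  simp only [le_antisymm_iff]
  rw [iSup_span_shadowCoeff_le_iSup_iff_forall_of_classes hRst hRirr hsep ι ι' hιeq hι'eq hind hind' hb hb',
    iSup_span_shadowCoeff_le_iSup_iff_forall_of_classes hRst hRirr hsep ι' ι hι'eq hιeq hind' hind hb' hb,
    ← forall_and]

end Summit.HodgeConjecture.CorCM.IrrOdd

end
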